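import Summits.BirchSwinnertonDyer.BirchSwinnertonDyer.Theses.ShadowIsolation
import Literature.NumberTheory.EllipticCurves.MazurTorsionGaloisStructureProofs
import Literature.NumberTheory.EllipticCurves.RationalIsogenyFrobeniusCriterion
import Literature.NumberTheory.EllipticCurves.PointCountEulerCriterion

/-!
# Crux `ShaCotorsionReducible` (stmt-BirchSwinnertonDyer-15277): the Eisenstein sector at `p = 7` is
# inhabited — `(26B1, 7)`

Negative-side support for `R = Summit.BirchSwinnertonDyer.BirchSwinnertonDyer.Theses.ShadowIsolation.ShaCotorsionReducible`
(crux disprover, cycle 1, 2026-08-17; companion of `Negative/SectorNonempty.lean`, which treats `p = 5`).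
The sector of the crux is `p ∈ {5, 7, 13, 37}` (rational `p`-isogeny with good ordinary reduction at `p`);
this file certifies a member at `p = 7`: Cremona's `26B1 = [1, -1, 1, -3, 3]`
(`y² + xy + y = x³ - x² - 3x + 3`, `Δ = -2⁷·13`), a global minimal equation with good reduction at `7`,
`#Ẽ(𝔽₇) = 7` (kernel point count, so `a₇ = 1`, ordinary), and the rational point `(1, 0)` of order `7`
(`2·(1,0) = (-1,-2)`, `3·(1,0) = (3,-6)`, `4·(1,0) = (3,2) = -3·(1,0)`), whence `E[7]` is reducible
(`not_hasIrreducibleModPGaloisRep_of_addOrderOf_eq`). Theorems only; nothing asserts a Theses statement.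

## References
* J. E. Cremona, *Algorithms for Modular Elliptic Curves*, 2nd ed. (1997), Table 1, `N = 26`, curve B1
  (`[1,-1,1,-3,3]`, `|T| = 7`). [CremonaAlgorithms1997]
* B. Mazur, Publ. Math. IHÉS 47 (1977), Ch. III §5 (Borel shape of `ρ̄_{E,N}` with rational `N`-torsion). [Mazur1977]
-/

set_option linter.dupNamespace false

noncomputable section

open scoped Classical

namespace Summit.BirchSwinnertonDyer.BirchSwinnertonDyer.Theorems.ShaCotorsionReducible.Negative

open Literature.NumberTheory.EllipticCurves WeierstrassCurve

/-- `#Ẽ(𝔽₇) = 7` (so `a₇ = 1`) for `26B1 = [1, -1, 1, -3, 3]`, kernel-decided.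
[cite: CremonaAlgorithms1997, Table 1, N = 26, curve B1] -/
theorem card_int26B1_mod_seven :
    Nat.card (((⟨1, -1, 1, -3, 3⟩ : WeierstrassCurve ℤ).map (Int.castRingHom (ZMod 7))).toAffine.Point)
      = 7 := by
  rw [@WeierstrassCurve.natCard_point_eq_one_add_card (ZMod 7) (@ZMod.instField 7 ⟨by norm_num⟩) _ _ _
    (by decide +kernel), @card_sol_eq_sum_euler (ZMod 7) (@ZMod.instField 7 ⟨by norm_num⟩) _ _
    (by rw [ZMod.ringChar_zmod_n]; decide), ZMod.card]
  decide +kernel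

/-- `(1, 0) ∈ 26B1(ℚ)` is nonsingular. [folklore] -/
theorem nonsingular_26B1_T : (⟨1, -1, 1, -3, 3⟩ : WeierstrassCurve ℚ).toAffine.Nonsingular 1 0 :=
  (Affine.nonsingular_iff' _ _).mpr ⟨(Affine.equation_iff _ _).mpr (by norm_num), Or.inr (by norm_num)⟩

/-- `(-1, -2) ∈ 26B1(ℚ)` is nonsingular. [folklore] -/
theorem nonsingular_26B1_T2 : (⟨1, -1, 1, -3, 3⟩ : WeierstrassCurve ℚ).toAffine.Nonsingular (-1) (-2) :=
  (Affine.nonsingular_iff' _ _).mpr ⟨(Affine.equation_iff _ _).mpr (by norm_num), Or.inr (by norm_num)⟩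

/-- `(3, -6) ∈ 26B1(ℚ)` is nonsingular. [folklore] -/
theorem nonsingular_26B1_T3 : (⟨1, -1, 1, -3, 3⟩ : WeierstrassCurve ℚ).toAffine.Nonsingular 3 (-6) :=
  (Affine.nonsingular_iff' _ _).mpr ⟨(Affine.equation_iff _ _).mpr (by norm_num), Or.inr (by norm_num)⟩

/-- `(1,0) + (1,0) = (-1,-2)` (tangent slope `-1`). [cite: CremonaAlgorithms1997, Table 1, N = 26, curve B1] -/
theorem T26_add_T26 [DecidableEq ℚ] :
    (Affine.Point.some 1 0 nonsingular_26B1_T : (⟨1, -1, 1, -3, 3⟩ : WeierstrassCurve ℚ).toAffine.Point)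
      + Affine.Point.some 1 0 nonsingular_26B1_T = Affine.Point.some (-1) (-2) nonsingular_26B1_T2 := by
  have hy : (0 : ℚ) ≠ (⟨1, -1, 1, -3, 3⟩ : WeierstrassCurve ℚ).toAffine.negY 1 0 := by
    norm_num [Affine.negY]
  rw [Affine.Point.add_self_of_Y_ne hy]
  congr 1
  · rw [Affine.slope_of_Y_ne rfl hy]
    norm_num [Affine.addX, Affine.negY]
  · rw [Affine.slope_of_Y_ne rfl hy]
    norm_num [Affine.addY, Affine.negAddY, Affine.addX, Affine.negY]

/-- `(-1,-2) + (1,0) = (3,-6)` (chord slope `1`). [cite: CremonaAlgorithms1997, Table 1, N = 26, curve B1] -/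
theorem T26two_add_T26 [DecidableEq ℚ] :
    (Affine.Point.some (-1) (-2) nonsingular_26B1_T2 : (⟨1, -1, 1, -3, 3⟩ : WeierstrassCurve ℚ).toAffine.Point)
      + Affine.Point.some 1 0 nonsingular_26B1_T = Affine.Point.some 3 (-6) nonsingular_26B1_T3 := by
  have hx : (-1 : ℚ) ≠ 1 := by norm_num
  rw [Affine.Point.add_of_X_ne hx]
  congr 1
  · rw [Affine.slope_of_X_ne hx]
    norm_num [Affine.addX]
  · rw [Affine.slope_of_X_ne hx]
    norm_num [Affine.addY, Affine.negAddY, Affine.addX, Affine.negY]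

/-- `(-1,-2) + (-1,-2) = (3, 2) = -(3,-6)` (tangent slope `-1`).
[cite: CremonaAlgorithms1997, Table 1, N = 26, curve B1] -/
theorem T26two_add_T26two [DecidableEq ℚ] :
    (Affine.Point.some (-1) (-2) nonsingular_26B1_T2 : (⟨1, -1, 1, -3, 3⟩ : WeierstrassCurve ℚ).toAffine.Point)
      + Affine.Point.some (-1) (-2) nonsingular_26B1_T2 = -Affine.Point.some 3 (-6) nonsingular_26B1_T3 := by
  have hy : (-2 : ℚ) ≠ (⟨1, -1, 1, -3, 3⟩ : WeierstrassCurve ℚ).toAffine.negY (-1) (-2) := by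
    norm_num [Affine.negY]
  rw [Affine.Point.add_self_of_Y_ne hy, Affine.Point.neg_some]
  congr 1
  · rw [Affine.slope_of_Y_ne rfl hy]
    norm_num [Affine.addX, Affine.negY]
  · rw [Affine.slope_of_Y_ne rfl hy]
    norm_num [Affine.addY, Affine.negAddY, Affine.addX, Affine.negY]

/-- **`7 · (1,0) = O` on `26B1`.** [cite: CremonaAlgorithms1997, Table 1, N = 26, curve B1 (|T| = 7)] -/
theorem seven_nsmul_T26 [DecidableEq ℚ] :
    (7 : ℕ) • (Affine.Point.some 1 0 nonsingular_26B1_T :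
      (⟨1, -1, 1, -3, 3⟩ : WeierstrassCurve ℚ).toAffine.Point) = 0 := by
  rw [show (7 : ℕ) = (2 + 2) + (2 + 1) from rfl, add_nsmul, add_nsmul, add_nsmul, two_nsmul, one_nsmul,
    T26_add_T26, T26two_add_T26two, T26two_add_T26, neg_add_cancel]

/-- **`(26B1, 7)` satisfies every hypothesis of the crux**: `[1,-1,1,-3,3]` over `ℚ` is elliptic and a
global minimal equation (`|Δ| = 2⁷·13 < 2¹²`, finite check), has good reduction at `7` (`7 ∤ Δ`), is
ordinary there (`a₇ = 7 + 1 - 7 = 1`), and `E[7]` is reducible (rational point `(1,0)` of order `7`).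
[cite: CremonaAlgorithms1997, Table 1, N = 26, curve B1] [cite: Mazur1977, Ch. III §5, p. 157] -/
theorem shaCotorsionReducible_sector_26B1 :
    ∃ (_ : ((⟨1, -1, 1, -3, 3⟩ : WeierstrassCurve ℤ).baseChange ℚ).IsElliptic)
      (_ : ((⟨1, -1, 1, -3, 3⟩ : WeierstrassCurve ℤ).baseChange ℚ).IsGloballyMinimal)
      (_ : Fact (Nat.Prime 7)),
      ((⟨1, -1, 1, -3, 3⟩ : WeierstrassCurve ℤ).baseChange ℚ).HasGoodReductionAtPrime 7 ∧
      ((⟨1, -1, 1, -3, 3⟩ : WeierstrassCurve ℤ).baseChange ℚ).frobeniusTrace 7 = 1 ∧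
      ¬ (7 : ℤ) ∣ ((⟨1, -1, 1, -3, 3⟩ : WeierstrassCurve ℤ).baseChange ℚ).frobeniusTrace 7 ∧
      ¬ ((⟨1, -1, 1, -3, 3⟩ : WeierstrassCurve ℤ).baseChange ℚ).HasIrreducibleModPGaloisRep 7 := by
  haveI h7 : Fact (Nat.Prime 7) := ⟨by norm_num⟩
  set E₀ : WeierstrassCurve ℤ := ⟨1, -1, 1, -3, 3⟩ with hE₀
  have hbc : E₀.baseChange ℚ = (⟨1, -1, 1, -3, 3⟩ : WeierstrassCurve ℚ) := by
    ext <;> simp [hE₀, WeierstrassCurve.baseChange, WeierstrassCurve.map]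
  have hΔ : E₀.Δ = -1664 := by
    rw [hE₀]
    norm_num [WeierstrassCurve.Δ, WeierstrassCurve.b₂, WeierstrassCurve.b₄, WeierstrassCurve.b₆,
      WeierstrassCurve.b₈]
  haveI hE : (E₀.baseChange ℚ).IsElliptic := isElliptic_baseChange_int E₀ (by rw [hΔ]; decide)
  haveI hmin : (E₀.baseChange ℚ).IsGloballyMinimal :=
    isGloballyMinimal_baseChange_int E₀ (forall_not_pow_dvd_or_of_bound E₀ (B := 2)
      (by rw [hE₀]; decide +kernel) (by rw [hΔ]; decide) (by rw [hE₀]; decide +kernel))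
  have htr : (E₀.baseChange ℚ).frobeniusTrace 7 = 1 := by
    rw [frobeniusTrace_baseChange_int E₀ card_int26B1_mod_seven]; norm_num
  refine ⟨hE, hmin, h7, ?_, htr, by rw [htr]; decide, ?_⟩
  · exact hasGoodReductionAtPrime_baseChange_int E₀ 7 (by rw [hΔ]; decide)
  · haveI : (⟨1, -1, 1, -3, 3⟩ : WeierstrassCurve ℚ).IsElliptic := by rw [← hbc]; exact hE
    rw [hbc]
    exact not_hasIrreducibleModPGaloisRep_of_addOrderOf_eq (⟨1, -1, 1, -3, 3⟩ : WeierstrassCurve ℚ)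
      (addOrderOf_eq_prime seven_nsmul_T26 (Affine.Point.some_ne_zero _))

/-- **The sector of the crux is inhabited at `p = 7` as well** (not only at `p = 5`,
`shaCotorsionReducible_hypotheses_satisfiable`): some `(W, 7)` satisfies all hypotheses of
`ShaCotorsionReducible`. [cite: CremonaAlgorithms1997, Table 1, N = 26, curve B1] -/
theorem shaCotorsionReducible_hypotheses_satisfiable_seven :
    ∃ (W : WeierstrassCurve ℚ) (_ : W.IsElliptic) (_ : W.IsGloballyMinimal) (_ : Fact (Nat.Prime 7)),
      5 ≤ 7 ∧ W.HasGoodReductionAtPrime 7 ∧ ¬ (7 : ℤ) ∣ W.frobeniusTrace 7 ∧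
      ¬ W.HasIrreducibleModPGaloisRep 7 := by
  obtain ⟨hE, hmin, h7, hgood, -, hord, hred⟩ := shaCotorsionReducible_sector_26B1
  exact ⟨_, hE, hmin, h7, by norm_num, hgood, hord, hred⟩

end Summit.BirchSwinnertonDyer.BirchSwinnertonDyer.Theorems.ShaCotorsionReducible.Negative

end
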